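import Summits.AtomisticToContinuum.FouriersLaw.Theorems.BondHeatUncertaintySubdiffusiveBondHeatOfFloorTransient
import Summits.AtomisticToContinuum.FouriersLaw.Theorems.BondHeatUncertaintySubdiffusiveBondHeatEscapeDeficitNonneg
import Summits.AtomisticToContinuum.FouriersLaw.Theorems.BondHeatUncertaintyTransferToBoundedResponse
import Summits.AtomisticToContinuum.FouriersLaw.Theorems.BondHeatUncertaintyLinearResponseFTUR
import Summits.AtomisticToContinuum.FouriersLaw.Theorems.JunctionLocalitySuperadditiveResistanceStubLinearResponsePlain
import Summits.AtomisticToContinuum.FouriersLaw.Theorems.EmbeddedDrudeMourreNessUnique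
import Literature.MathematicalPhysics.KineticTheory.LangevinChainNESSHolds

/-!
# Crux-strategist s2 (stmt-AtomisticToContinuum-9120 `SubdiffusiveBondHeat`): the CIRCULARITY WITNESS

Census artifact (§Decomposition of `Cruxes/SubdiffusiveBondHeat/STRATEGY-CENSUS.md`, strategist s2, 2026-08-17).
Kernel-checked statement of why the only typed split of the crux, `(S) ⟸ OhmicFloor ∧ TransientEW` ((D1) of strategist s1,
glue landed as `subdiffusiveBondHeat_of_ohmicFloor_transientEW`, p138777), CANNOT be filed as `route edit --split` on route
`BondHeatUncertainty`: its Ohm-carrying child `OhmicFloor` is EQUIVALENT, in tree and unconditionally, to the route's own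
OUTPUT `BondHeatUncertainty.BoundedResponse` (stmt-AtomisticToContinuum-11071) — because the response identity
`D_N = (N−1)·γ·E_N` (`BoundaryEscapeDeficit.ResponseIdentity`, stmt-12237) is now PROVED in tree
(`ThermaliseThenCutProbeInsertion.responseIdentity_proof`, file `JunctionLocalitySuperadditiveResistanceStubLinearResponsePlain.lean`),
weak-NESS uniqueness is proved (`Theorems.nessUnique_proof`), steady states exist (`pinnedChain_exists_isSteadyState`) and
`0 ≤ E_N` is proved (`escapeDeficit_nonneg`).  Consequently, with the route's transfer (`transferToBoundedResponse_proof`, p-landed)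
and the proved engine `LinearResponseFTUR_proof`:

  `ExtensiveSnapshotIrreversibility → TransientEW → (SubdiffusiveBondHeat ↔ BoundedResponse)`.

Filing (D1) would therefore make `closes` consume (a restatement of) the statement it produces.  No `sorry`; standard axioms.
Nothing here closes an item.
-/

noncomputable section

open MeasureTheory Filter Topology Set
open Literature.MathematicalPhysics.KineticTheory.HeatConduction

namespace Summit.AtomisticToContinuum.FouriersLaw.Cruxes.SubdiffusiveBondHeat.Strategist

open Summit.AtomisticToContinuum.FouriersLaw.Theses.BondHeatUncertainty
  (SubdiffusiveBondHeat ExtensiveSnapshotIrreversibility LinearResponseFTUR NessUnique BoundedResponse)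
open Summit.AtomisticToContinuum.FouriersLaw.Theses.BoundaryEscapeDeficit (ResponseIdentity)
open Summit.AtomisticToContinuum.FouriersLaw.Theorems.SubdiffusiveBondHeat
  (subdiffusiveBondHeat_of_ohmicFloor_transientEW escapeDeficit_nonneg)

/-- (D1a) **Ohmic floor at the contact**: `E_N = 1 − (γ/T²)∫_{(0,∞)} K_N ≤ C₁/N` for all large `N` — VERBATIM hypothesis 1
of the landed glue `subdiffusiveBondHeat_of_ohmicFloor_transientEW` (= former stub `stub_ohmicFloor`). -/
def OhmicFloor : Prop :=
  ∀ ω₂ lam β γ : ℝ, 0 < ω₂ → 0 < lam → 0 < β → 0 < γ → ∀ T : ℝ, 0 < T →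
    ∃ C₁ : ℝ, ∃ N₀ : ℕ, ∀ N : ℕ, N₀ ≤ N →
      1 - γ / T ^ 2 * (∫ u in Set.Ioi (0 : ℝ),
        if h : 0 < N then
          ∫ z, ((z.2 ⟨0, h⟩) ^ 2 - T) *
              (∫ y, ((y.2 ⟨0, h⟩) ^ 2 - T) ∂((pinnedChain ω₂ lam β γ).transitionKernel N T T u.toNNReal z))
            ∂((pinnedChain ω₂ lam β γ).gibbsMeasure N T)
        else 0) ≤ C₁ / (N : ℝ)

/-- (D1b) **Edwards–Wilkinson transient of the bath heat**: `∫₀ᵗ (1 − θ_N(s) − E_N) ds ≤ C₂√t` on `[1, cN²]`, `N ≥ N₀` — VERBATIM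
hypothesis 2 of `subdiffusiveBondHeat_of_ohmicFloor_transientEW` (= former stub `stub_transientEW`; the Ohm-free half). -/
def TransientEW : Prop :=
  ∀ ω₂ lam β γ : ℝ, 0 < ω₂ → 0 < lam → 0 < β → 0 < γ → ∀ T : ℝ, 0 < T →
    ∃ C₂ c : ℝ, 0 < c ∧ ∃ N₀ : ℕ, ∀ N : ℕ, N₀ ≤ N → ∀ t : ℝ, 1 ≤ t → t ≤ c * (N : ℝ) ^ 2 →
      (∫ s in (0 : ℝ)..t,
        (1 - γ / T ^ 2 * (∫ u in (0 : ℝ)..s,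
            if h : 0 < N then
              ∫ z, ((z.2 ⟨0, h⟩) ^ 2 - T) *
                  (∫ y, ((y.2 ⟨0, h⟩) ^ 2 - T)
                    ∂((pinnedChain ω₂ lam β γ).transitionKernel N T T u.toNNReal z))
                ∂((pinnedChain ω₂ lam β γ).gibbsMeasure N T)
            else 0) -
          (1 - γ / T ^ 2 * (∫ u in Set.Ioi (0 : ℝ),
            if h : 0 < N then
              ∫ z, ((z.2 ⟨0, h⟩) ^ 2 - T) *
                  (∫ y, ((y.2 ⟨0, h⟩) ^ 2 - T)
                    ∂((pinnedChain ω₂ lam β γ).transitionKernel N T T u.toNNReal z))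
                ∂((pinnedChain ω₂ lam β γ).gibbsMeasure N T)
            else 0)))) ≤ C₂ * Real.sqrt t

/-! ## Abstract real arithmetic -/

/-- `|D_N| ≤ S` and `D_N = (N−1)γE_N` (`N ≥ 1`) give the floor `E_N ≤ (2S/γ)/N` for `N ≥ 2`. [folklore] -/
theorem floor_of_abs_le {E D : ℕ → ℝ} {γ S : ℝ} (hγ : 0 < γ)
    (hD : ∀ N : ℕ, 0 < N → D N = ((N : ℝ) - 1) * γ * E N) (hS : ∀ N : ℕ, |D N| ≤ S) :
    ∃ C₁ : ℝ, ∃ N₀ : ℕ, ∀ N : ℕ, N₀ ≤ N → E N ≤ C₁ / (N : ℝ) := by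
  refine ⟨2 * S / γ, 2, fun N hN => ?_⟩
  have hNr : (2 : ℝ) ≤ N := by exact_mod_cast hN
  have hNpos : (0 : ℝ) < N := by linarith
  have hpos : 0 < ((N : ℝ) - 1) * γ := mul_pos (by linarith) hγ
  have hS0 : 0 ≤ S := (abs_nonneg _).trans (hS N)
  have hle : ((N : ℝ) - 1) * γ * E N ≤ S := by
    rw [← hD N (by omega)]; exact (le_abs_self _).trans (hS N)
  have h1 : E N ≤ S / (((N : ℝ) - 1) * γ) := by
    rw [le_div_iff₀ hpos]
    calc E N * (((N : ℝ) - 1) * γ) = ((N : ℝ) - 1) * γ * E N := by ring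
      _ ≤ S := hle
  have h2 : S / (((N : ℝ) - 1) * γ) ≤ 2 * S / γ / (N : ℝ) := by
    rw [div_le_div_iff₀ hpos hNpos]
    have : (N : ℝ) ≤ 2 * ((N : ℝ) - 1) := by linarith
    calc S * (N : ℝ) ≤ S * (2 * ((N : ℝ) - 1)) := mul_le_mul_of_nonneg_left this hS0
      _ = 2 * S / γ * (((N : ℝ) - 1) * γ) := by field_simp
  exact h1.trans h2

/-- Conversely, `D_N = (N−1)γE_N` (`N ≥ 1`), `0 ≤ E_N` (`N ≥ 2`) and the floor `E_N ≤ C₁/N` (`N ≥ N₀`) give a bounded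
`|D_N|` (eventually `≤ γ·max C₁ 0`, finitely many `N` before). [folklore] -/
theorem bddAbove_abs_of_floor {E D : ℕ → ℝ} {γ C₁ : ℝ} {N₀ : ℕ} (hγ : 0 < γ)
    (hD : ∀ N : ℕ, 0 < N → D N = ((N : ℝ) - 1) * γ * E N) (hE0 : ∀ N : ℕ, 2 ≤ N → 0 ≤ E N)
    (hfl : ∀ N : ℕ, N₀ ≤ N → E N ≤ C₁ / (N : ℝ)) :
    BddAbove (Set.range fun N : ℕ => |D N|) := by
  have hev : ∀ N : ℕ, max N₀ 2 ≤ N → |D N| ≤ γ * max C₁ 0 := by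
    intro N hN
    have hN2 : 2 ≤ N := le_trans (le_max_right _ _) hN
    have hN0 : N₀ ≤ N := le_trans (le_max_left _ _) hN
    have hNr : (2 : ℝ) ≤ N := by exact_mod_cast hN2
    have hNpos : (0 : ℝ) < N := by linarith
    have hN1 : 0 ≤ (N : ℝ) - 1 := by linarith
    have hEN := hE0 N hN2
    have hDN : D N = ((N : ℝ) - 1) * γ * E N := hD N (by omega)
    have hDnn : 0 ≤ D N := by rw [hDN]; positivity
    rw [abs_of_nonneg hDnn, hDN]
    have hE1 : E N ≤ max C₁ 0 / (N : ℝ) :=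
      (hfl N hN0).trans (div_le_div_of_nonneg_right (le_max_left _ _) hNpos.le)
    have hE2 : ((N : ℝ) - 1) * E N ≤ max C₁ 0 := by
      have h := mul_le_mul_of_nonneg_left hE1 hN1
      have h' : ((N : ℝ) - 1) * (max C₁ 0 / (N : ℝ)) ≤ max C₁ 0 := by
        rw [mul_div_assoc']
        rw [div_le_iff₀ hNpos]
        nlinarith [le_max_right C₁ 0]
      exact h.trans h'
    calc ((N : ℝ) - 1) * γ * E N = γ * (((N : ℝ) - 1) * E N) := by ring
      _ ≤ γ * max C₁ 0 := mul_le_mul_of_nonneg_left hE2 hγ.le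
  have hbu : IsBoundedUnder (· ≤ ·) atTop (fun N : ℕ => |D N|) :=
    ⟨γ * max C₁ 0, eventually_atTop.2 ⟨max N₀ 2, hev⟩⟩
  rw [← Nat.cofinite_eq_atTop] at hbu
  exact hbu.bddAbove_range_of_cofinite

/-! ## The in-tree facts, by name -/

/-- Weak-NESS uniqueness (item 0741), proved in tree; the `NessUnique` decls of all routes are syntactically identical. -/
theorem nessUnique_holds : NessUnique :=
  Summit.AtomisticToContinuum.FouriersLaw.Theorems.nessUnique_proof

/-- The response identity `D_N = (N−1)γE_N` (item 12237), proved in tree (boundary Kubo identity of route `PhononMeanFreePath`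
transported by `boundaryKubo_iff_responseIdentity`). -/
theorem responseIdentity_holds : ResponseIdentity :=
  Summit.AtomisticToContinuum.FouriersLaw.Cruxes.SuperadditiveResistance.ThermaliseThenCutProbeInsertion.responseIdentity_proof

/-! ## (D1a) is the route's output -/

/-- **`BoundedResponse ⟹ OhmicFloor`.**  Along the canonical steady-state family (existence theorem + choice), the proved
response identity supplies response coefficients `D_N = (N−1)γE_N` (`N ≥ 1`; `D_0 = 0` by `totalCurrent_zero`); bounded
`|D_N|` is then the Ohmic floor `E_N ≤ (2 sup|D|/γ)/N`. [folklore] -/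
theorem ohmicFloor_of_boundedResponse : BoundedResponse → OhmicFloor := by
  intro hB ω₂ lam β γ hω hl hβ hγ T hT
  classical
  have huniq := nessUnique_holds ω₂ lam β γ hω hl hβ hγ
  -- the canonical steady-state family
  let μ₀ : (N : ℕ) → ℝ → ℝ → MeasureTheory.Measure (PhaseSpace N) := fun N T_L T_R =>
    if h : 0 < T_L ∧ 0 < T_R then
      Classical.choose (pinnedChain_exists_isSteadyState hω hl hβ hγ N h.1 h.2) else 0
  have hμ₀ : ∀ (N : ℕ) (T_L T_R : ℝ), 0 < T_L → 0 < T_R →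
      (pinnedChain ω₂ lam β γ).IsSteadyState N T_L T_R (μ₀ N T_L T_R) := by
    intro N T_L T_R hL' hR'
    simp only [μ₀, dif_pos (And.intro hL' hR')]
    exact Classical.choose_spec (pinnedChain_exists_isSteadyState hω hl hβ hγ N hL' hR')
  have hRI := responseIdentity_holds ω₂ lam β γ hω hl hβ hγ huniq μ₀ hμ₀ T hT
  dsimp only at hRI
  -- the escape expression
  let E : ℕ → ℝ := fun N => 1 - γ / T ^ 2 * (∫ u in Set.Ioi (0 : ℝ),
        if h : 0 < N then
          ∫ z, ((z.2 ⟨0, h⟩) ^ 2 - T) *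
              (∫ y, ((y.2 ⟨0, h⟩) ^ 2 - T) ∂((pinnedChain ω₂ lam β γ).transitionKernel N T T u.toNNReal z))
            ∂((pinnedChain ω₂ lam β γ).gibbsMeasure N T)
        else 0)
  let D : ℕ → ℝ := fun N => if N = 0 then 0 else ((N : ℝ) - 1) * γ * E N
  have hDpos : ∀ N : ℕ, 0 < N → D N = ((N : ℝ) - 1) * γ * E N := fun N hN => by
    simp [D, hN.ne']
  have hD : ∀ N : ℕ, Tendsto
      (fun δ : ℝ => (pinnedChain ω₂ lam β γ).totalCurrent (μ₀ N (T + δ / 2) (T - δ / 2)) / δ)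
      (𝓝[≠] 0) (𝓝 (D N)) := by
    intro N
    rcases Nat.eq_zero_or_pos N with rfl | hN
    · have hD0 : D 0 = 0 := by simp [D]
      rw [hD0]
      simp only [OscillatorChain.totalCurrent_zero, zero_div]
      exact tendsto_const_nhds
    · rw [hDpos N hN]
      exact (hRI N hN).2
  obtain ⟨S, hS⟩ := hB ω₂ lam β γ hω hl hβ hγ μ₀ hμ₀ T hT D hD
  have hS' : ∀ N : ℕ, |D N| ≤ S := fun N => hS ⟨N, rfl⟩
  exact floor_of_abs_le hγ hDpos hS'

/-- **`OhmicFloor ⟹ BoundedResponse`.**  Along ANY steady-state family with response coefficients `D`, uniqueness of limits in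
`𝓝[≠] 0` and the proved response identity give `D_N = (N−1)γE_N` (`N ≥ 1`); `0 ≤ E_N` (`escapeDeficit_nonneg`, `N ≥ 2`) and the
floor bound `|D_N|` eventually by `γ·max C₁ 0`. [folklore] -/
theorem boundedResponse_of_ohmicFloor : OhmicFloor → BoundedResponse := by
  intro hO ω₂ lam β γ hω hl hβ hγ μ hμ T hT D hD
  have huniq := nessUnique_holds ω₂ lam β γ hω hl hβ hγ
  have hRI := responseIdentity_holds ω₂ lam β γ hω hl hβ hγ huniq μ hμ T hT
  dsimp only at hRI
  obtain ⟨C₁, N₀, hfl⟩ := hO ω₂ lam β γ hω hl hβ hγ T hT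
  have hE0 := escapeDeficit_nonneg ω₂ lam β γ hω hl hβ hγ T hT
  have hDpos : ∀ N : ℕ, 0 < N → D N = ((N : ℝ) - 1) * γ * (1 - γ / T ^ 2 * (∫ u in Set.Ioi (0 : ℝ),
        if h : 0 < N then
          ∫ z, ((z.2 ⟨0, h⟩) ^ 2 - T) *
              (∫ y, ((y.2 ⟨0, h⟩) ^ 2 - T) ∂((pinnedChain ω₂ lam β γ).transitionKernel N T T u.toNNReal z))
            ∂((pinnedChain ω₂ lam β γ).gibbsMeasure N T)
        else 0)) := fun N hN =>
    tendsto_nhds_unique (hD N) (hRI N hN).2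
  exact bddAbove_abs_of_floor (N₀ := N₀) hγ hDpos hE0 hfl

/-- **(D1a) ⟺ the route's output.** -/
theorem boundedResponse_iff_ohmicFloor : BoundedResponse ↔ OhmicFloor :=
  ⟨ohmicFloor_of_boundedResponse, boundedResponse_of_ohmicFloor⟩

/-! ## The cycle -/

/-- Forward (the route, all in tree): `(S) ∧ (K) ⟹ BoundedResponse` — `transferToBoundedResponse_proof` fed with the proved engine
`LinearResponseFTUR_proof` and the proved `NessUnique`. -/
theorem boundedResponse_of_subdiffusiveBondHeat :
    ExtensiveSnapshotIrreversibility → SubdiffusiveBondHeat → BoundedResponse := fun hK hS =>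
  Summit.AtomisticToContinuum.FouriersLaw.Theorems.transferToBoundedResponse_proof hS hK
    Summit.AtomisticToContinuum.FouriersLaw.Theorems.LinearResponseFTUR_proof nessUnique_holds

/-- Backward: `BoundedResponse ∧ TransientEW ⟹ (S)` — the landed glue (p138777) with the floor discharged from the route's output. -/
theorem subdiffusiveBondHeat_of_boundedResponse_transientEW :
    BoundedResponse → TransientEW → SubdiffusiveBondHeat := fun hB hT =>
  subdiffusiveBondHeat_of_ohmicFloor_transientEW (ohmicFloor_of_boundedResponse hB) hT

/-- **THE CIRCULARITY WITNESS.**  Modulo the route's other crux `(K)` and the Ohm-free transient `TransientEW`, the crux `(S)` of route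
`BondHeatUncertainty` is EQUIVALENT to the route's output `BoundedResponse` — so the split `(S) ⟸ OhmicFloor ∧ TransientEW` would make
`closes` consume its own conclusion.  Everything in tree except the two displayed hypotheses. -/
theorem subdiffusiveBondHeat_iff_boundedResponse :
    ExtensiveSnapshotIrreversibility → TransientEW → (SubdiffusiveBondHeat ↔ BoundedResponse) := fun hK hT =>
  ⟨boundedResponse_of_subdiffusiveBondHeat hK, fun hB => subdiffusiveBondHeat_of_boundedResponse_transientEW hB hT⟩

end Summit.AtomisticToContinuum.FouriersLaw.Cruxes.SubdiffusiveBondHeat.Strategist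

end
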